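import Summits.BirchSwinnertonDyer.BirchSwinnertonDyer.Theorems.KimAtThreeShallowEqDeepStubOfWitnesses
import Summits.BirchSwinnertonDyer.BirchSwinnertonDyer.Theorems.KimAtThreeDeepUpperOfPortsDevissage
import HarnessLib

/-!
# Route `KimAtThreeKolyvagin` (rung W2), cruxes `DeepUpperAtThree` (19076) / `ShallowEqDeepAtTorsionFree`
# (19077): the END-OF-PORTS theorem on the Kato stratum with NO inline port — the STUB discharged

Cell `bsd-addord`, seat `bsd-addord-w2-c4` (D-0074 row B7), gen 4; sequel of
`KimAtThreeShallowEqDeepStubOfOrder` (p442371) and `KimAtThreeShallowEqDeepStubOfWitnesses`.  ONE theorem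
(no definition, no named fact, no `sorry`); cruxes 19076/19077 stay OPEN; nothing asserted about any curve.
CONDITIONAL, by hypothesis, on: the two [S24] Thm. 4.4 facts `hS24`/`hS24₂` (PUB, typed weaker than
print), GZK `hGZK` (PUB), the Poitou–Tate families `inv`/`inv′` (data binders, supplied from the named
fact `poitouTate_selmerStructure_duality ℚ` in the sequel), and ONE dictionary port
`KatoKuriharaPortThreeAtWith₂ W 0 v₃ η D` (FLAG `K22-Thm3.13-PORT@3`: Kim's explicit reciprocity law at an
additive `3` — NOT in print at `3`; the SAME debt every Kato-stratum file of the route carries).  NO inline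
port: w2-c3's `hDev` is their theorem `kummerDevissage_of_towerSurj` (p433736) and their `hStub`
(Mazur–Rubin Thm. 4.4.1 at `∅`, general `m`) is this seat's `exists_eq_nsmul_add_of_witnesses` — at the
depth `k = k₀ + 2a + 2s` the weakened stub follows from [S24] Thm. 4.4 (2) at `∅` in ORDER form (already in
the tower family, `hR22′`), the PT count, Kato's `κ_∅`, and a class of full order pushed down from the
port's witness at depth `k₂ = k + a + 1`.

WHAT.  `deepUpper_conclusion_of_ports_noStub`: on a row {`W` globally minimal, ADDITIVE at `3` with
`3 ∤ c₃`, the `3`-adic tower onto, `E(ℚ₃)[3] = 0`, `L(E,1) ≠ 0`, a parametrisation datum `D` with `3 ∤ c_D`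
and the `3`-adic period transfer, `3`-integral plus symbols of `D.f`}, the inputs above give
`∃ d, ∂^{(∞)}_deep(δ̃) = d ∧ ord₃ #Ш(E/ℚ)(3) + d ≤ ∂⁽⁰⁾(δ̃)` — the conclusion of crux 19076 at the row for
the newform `D.f`.  The proof is w2-c3's `KimAtThreeDeepUpperOfPorts.deepUpper_conclusion_of_ports`
(p431940) VERBATIM (every step and every name theirs) except: the depth `k = k₀ + 2a + 2s`; step (3)
(the inline stub) replaced by step (5′) (the stub from orders); `hDev` replaced by
`kummerDevissage_of_towerSurj W htower η`.  Crux 19077 on the same rows follows in the sequel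
`KimAtThreeShallowEqDeepNoStubCruxes` (kim3's `shallowEqDeep_conclusion_of_ports_of_deepUpper`).
NOT COVERED: `3 ∣ c₃` (Kodaira IV/IV*: the port's two-exponent form), `t ≥ 1`, non-additive `3`.
[cite: Kim2025RefinedTNC, Thm 1.1, §5] [cite: Kim2022StructureSelmer, Thm. 1.9 (6), Thm. 3.13, Lemma 3.14]
[cite: MazurRubin2004, Thm. 4.4.1, Thm. 4.1.13 (i), Cor. 4.1.9, Lemma 3.5.3, Thm. 5.2.12 (v)]
[cite: Rubin2011, Thm. 2.8.4 (p. 25), Cor. 2.7.3] [cite: Sakamoto2024, Thm. 4.4 (1)(2) (p. 926), Cor. 5.5 (p. 929)]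
[cite: Kato2004Asterisque, Thm. 12.5 (1)]
-/

set_option autoImplicit false
-- the Theorems namespace of a single-conjunct summit repeats the summit name by design (D-0017)
set_option linter.dupNamespace false

noncomputable section

open scoped Classical NumberField ContRepresentation
open Function Field NumberField IsDedekindDomain IsDedekindDomain.HeightOneSpectrum WeierstrassCurve
  CongruenceSubgroup
  Literature.NumberTheory.EllipticCurves Literature.NumberTheory.EllipticCurves.ModularForms
  Literature.NumberTheory.EllipticCurves.Rank1Residual
  Literature.NumberTheory.GaloisRepresentations
  Literature.NumberTheory.GaloisRepresentations.DiscreteGaloisModule Literature.NumberTheory.GaloisCohomology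
  Rat.HeightOneSpectrum
  Summit.BirchSwinnertonDyer.Rank1Residual.GaloisImage
  Summit.BirchSwinnertonDyer.Rank1Residual.GaloisImage.Assembly
  Summit.BirchSwinnertonDyer.Rank1Residual.X4
  Summit.BirchSwinnertonDyer.BirchSwinnertonDyer.Theorems
  Summit.BirchSwinnertonDyer.BirchSwinnertonDyer.Theorems.KimAtThreeDeepUpperCoreVertexKummer
  Summit.BirchSwinnertonDyer.BirchSwinnertonDyer.Theorems.KimAtThreeDeepUpperCoreVertexEnd
  Summit.BirchSwinnertonDyer.BirchSwinnertonDyer.Theorems.KimAtThreeDeepUpperSelmerSha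
  Summit.BirchSwinnertonDyer.BirchSwinnertonDyer.Theorems.KimAtThreeDeepUpperEndRow
  Summit.BirchSwinnertonDyer.BirchSwinnertonDyer.Theorems.KimAtThreeDeepLowerLevelSupply
  Summit.BirchSwinnertonDyer.BirchSwinnertonDyer.Theorems.KimAtThreeDeepUpperOfPortsDevissage
  Summit.BirchSwinnertonDyer.BirchSwinnertonDyer.Theorems.KimAtThreeShallowEqDeepStubOfWitnesses

namespace Summit.BirchSwinnertonDyer.BirchSwinnertonDyer.Theorems.KimAtThreeShallowEqDeepStubOfPorts

/-- **Crux 19076 at a row of the Kato stratum from the ports — NO inline port.**  Row: `W/ℚ` globally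
minimal, ADDITIVE at `3` with `3 ∤ c₃`, the `3`-adic tower onto, `E(ℚ₃)[3] = 0`, `L(E,1) ≠ 0`, a datum `D`
with `3 ∤ c_D`, the `3`-adic period transfer and `3`-integral plus symbols.  Inputs: `hS24`/`hS24₂` (PUB),
GZK (PUB), Poitou–Tate families `inv`, `inv′` (data binders; supplied from the named fact
`poitouTate_selmerStructure_duality ℚ` by `KimAtThreeDeepUpperOfPortsClasswide`), and ONE port
`KatoKuriharaPortThreeAtWith₂ W 0 v₃ η D` (FLAG `K22-Thm3.13-PORT@3`).  The former inline ports are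
THEOREMS: `hDev` by w2-c3's `kummerDevissage_of_towerSurj` (p433736) and `hStub` by this seat's
`exists_eq_nsmul_add_of_witnesses` at the depth `k = k₀ + 2a + 2s` (`2n₀ + a ≤ k + 1` by `n₀ ≤ s`), with
the port's witness at the deeper depth `k₂ = k + a + 1`.  The proof is w2-c3's
`KimAtThreeDeepUpperOfPorts.deepUpper_conclusion_of_ports` (p431940) VERBATIM except for steps (3)/(5′).
Conclusion: `∃ d, ∂^{(∞)}_deep(δ̃) = d ∧ ord₃ #Ш(E/ℚ)(3) + d ≤ ∂⁽⁰⁾(δ̃)` for `f = D.f` — crux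
`DeepUpperAtThree` at the row. [cite: Kim2025RefinedTNC, Thm 1.1, §5]
[cite: Kim2022StructureSelmer, Thm. 1.9 (6) and Thm. 3.13] [cite: MazurRubin2004, Thm. 4.4.1, Cor. 4.1.9, Lemma 3.5.3]
[cite: Sakamoto2024, Thm. 4.4 (1)(2) (p. 926)] -/
theorem deepUpper_conclusion_of_ports_noStub
    (hS24 : Sakamoto2024.kolyvaginSystems_freeRankOne_zmod_three_pow)
    (hS24₂ : Sakamoto2024.kolyvaginSystems_idealOfBasis_eq_fittingIdeal_zmod_three_pow)
    (hGZK : rank_eq_analyticRank_of_analyticRank_le_one)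
    (W : WeierstrassCurve ℚ) [W.IsElliptic] [W.IsGloballyMinimal]
    -- the row
    (hadd : haveI : Fact (Nat.Prime 3) := ⟨Nat.prime_three⟩; Addv W 3)
    (hc3 : ¬ 3 ∣ (W.baseChange ℚ_[3]).localTamagawaNumber ℤ_[3])
    (htower : ∀ m : ℕ, W.HasSurjectiveModNGaloisRep (3 ^ m : ℕ))
    (ht0 : Nat.card {Q : (W.baseChange ℚ_[3]).toAffine.Point // (3 : ℕ) • Q = 0} = 1)
    (hL : W.entireLFunction 1 ≠ 0)
    {N : ℕ} [NeZero N] (D : ModularParametrizationData W N) (hcD : ¬ (3 : ℤ) ∣ D.maninConstant)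
    (hper : ∃ u : ℚ, ‖(u : ℚ_[3])‖ = 1 ∧ W.realPeriodRat = u * plusPeriod D.f)
    (hint : ∀ r : ℚ, ratPlusSymbol D.f r ≠ 0 → 0 ≤ padicValRat 3 (ratPlusSymbol D.f r))
    -- the Poitou–Tate families
    (inv : LocalInvariants ℚ 3) (hperf : inv.IsPerfect) (hsum : inv.SumLocalTermEqZero)
    (hcompl : inv.SelmerComplement)
    (inv' : ∀ k' : ℕ, LocalInvariants ℚ (3 ^ (k' + 1))) (hperf' : ∀ k', (inv' k').IsPerfect)
    (hsum' : ∀ k', (inv' k').SumLocalTermEqZero) (hcompl' : ∀ k', (inv' k').SelmerComplement)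
    (hinj' : ∀ k', ∀ v : HeightOneSpectrum (𝓞 ℚ), Injective (inv' k' (Sum.inr v)))
    -- ONE dictionary port (repaired PORT″, shared generator family `η`, keyed at `D`)
    (v₃ : HeightOneSpectrum (𝓞 ℚ)) (hv₃ : ((3 : ℕ) : 𝓞 ℚ) ∈ v₃.asIdeal)
    (η : (q : HeightOneSpectrum (𝓞 ℚ)) → (ZMod (Ideal.absNorm q.asIdeal))ˣ)
    (hη : ∀ q : HeightOneSpectrum (𝓞 ℚ), Subgroup.zpowers (η q) = ⊤)
    (hPort : KatoKuriharaPortThreeAtWith₂ W 0 v₃ η D) :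
    ∃ dd : ℕ, kuriharaPartialDeepInfty W 3 D.f = dd ∧
      ((padicValNat 3 (Nat.card (AddCommGroup.primaryComponent W.sha 3)) + dd : ℕ) : ℕ∞) ≤
        kuriharaPartial W 3 D.f 0 := by
  haveI : Fact (Nat.Prime 3) := ⟨Nat.prime_three⟩
  haveI : NeZero ((3 : ℕ) : ℚ) := ⟨by norm_num⟩
  have hp2 : (3 : ℕ) ≠ 2 := by norm_num
  -- the row: analytic rank `0`, `E(ℚ)` and `Ш` finite, surjectivity, irreducibility, Manin, Tate's EP
  have hr : W.analyticRank = 0 := analyticRank_eq_zero_of_entireLFunction_one_ne_zero W hL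
  have hGZ := hGZK W (by rw [hr]; exact zero_le_one)
  haveI : Finite W.sha := hGZ.2
  haveI : Finite W.toAffine.Point := W.mordellWeilRank_eq_zero_iff_holds.mp (by rw [hGZ.1, hr])
  have hsurj : W.HasSurjectiveModNGaloisRep ((3 : ℕ) : ℤ) := by simpa using htower 1
  have hirr := hasIrreducibleModPGaloisRep_of_hasSurjectiveModNGaloisRep W 3 hsurj
  have hcP : ¬ ((3 : ℕ) : ℤ) ∣ D.maninConstant := by exact_mod_cast hcD
  have hEP : ∀ v : HeightOneSpectrum (𝓞 ℚ), localEulerPoincareCharacteristic (v.adicCompletion ℚ) :=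
    localEulerPoincareCharacteristic_rat
  have ht0' : Nat.card {Q : (W.baseChange ℚ_[3]).toAffine.Point // (3 : ℕ) • Q = 0} = 3 ^ 0 := by
    rw [ht0, pow_zero]
  -- the `L`-value: `a = ∂⁽⁰⁾(δ̃) = ord₃ [0]⁺_f`, and `δ̃₁ ≡ 3^a · unit` at every modulus
  have hint0 : ¬ 3 ∣ (ratPlusSymbol D.f 0).den :=
    not_dvd_den_of_norm_ratCast_le_one
      (D.isNewformOf.norm_ratPlusSymbol_le_one (x := 0) hp2 hirr (by simp))
  have hne0 : ratPlusSymbol D.f 0 ≠ 0 := by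
    intro h0
    apply hL
    rw [D.isNewformOf.entireLFunction_one_eq, h0]
    simp
  set a : ℕ := (padicValRat 3 (ratPlusSymbol D.f 0)).toNat with ha_def
  have hva : padicValRat 3 (ratPlusSymbol D.f 0) = a := by
    rw [ha_def, Int.toNat_of_nonneg (hint 0 hne0)]
  have ha : kuriharaPartial W 3 D.f 0 = a := by
    rw [kuriharaPartial_zero, kuriharaDivIndex_one_eq W 3 D.f hint0 hne0]
  -- `#Ш(E/ℚ)(3) = 3^s`
  obtain ⟨s, hs⟩ :=
    Literature.NumberTheory.EllipticCurves.exists_natCard_primaryComponent_eq_pow (A := W.sha) 3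
  -- the admissible set `T = {v ∣ 3} ∪ {bad}` and `S = S(T)`
  obtain ⟨T, h3T, hbadT, -, hT, h𝓕T, h𝓚T, hfinT, hfinS⟩ := TowerPackage.towerAdmissible W
  have hS : ∀ w : InfinitePlace ℚ, (Sum.inl w : Place ℚ) ∈ finSupport T := inl_mem_finSupport T
  have h3S : ∀ v : HeightOneSpectrum (𝓞 ℚ), ((3 : ℕ) : 𝓞 ℚ) ∈ v.asIdeal →
      (Sum.inr v : Place ℚ) ∈ finSupport T := fun v hv => (inr_mem_finSupport_iff T v).mpr (h3T v hv)
  have hbadS : ∀ v : HeightOneSpectrum (𝓞 ℚ), ¬ W.HasGoodReductionAt v →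
      (Sum.inr v : Place ℚ) ∈ finSupport T := fun v hv => (inr_mem_finSupport_iff T v).mpr (hbadT v hv)
  have hSgood : ∀ v ∉ {v : HeightOneSpectrum (𝓞 ℚ) | (Sum.inr v : Place ℚ) ∈ finSupport T},
      W.HasGoodReductionAt v ∧ ((3 : ℕ) : 𝓞 ℚ) ∉ v.asIdeal := fun v hv =>
    ⟨by_contra fun h => hv (hbadS v h), fun h => hv (h3S v h)⟩
  have hSbad : ∀ v ∉ {v : HeightOneSpectrum (𝓞 ℚ) | (Sum.inr v : Place ℚ) ∈ finSupport T},
      W.HasGoodReductionAt v := fun v hv => (hSgood v hv).1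
  have hv₃T : v₃ ∈ T := h3T v₃ hv₃
  -- the shared-`η` tower family (data, generators, [S24] 4.4 (2) in order form, local shape)
  obtain ⟨τ, D', g', hτμ, hτq, hP', hDT', hD', hg', -, hgen', hR22', hUT', hPS', -⟩ :=
    TowerPackage.exists_towerFamily_with W hS24 hS24₂ htower inv hperf hsum hcompl hEP (finSupport T) hS
      h3S hbadS η hη
  have hDk : ∀ k', (D' k').IsCanonicalTauDatumThreeAtWith W (k' + 0) k' η := fun k' =>
    isCanonicalTauDatumThreeAtWith_of_primes_eq hSgood (hτμ k') (hτq k') (hP' k') (hDT' k') (hD' k')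
  have hPSk : ∀ k', ∀ q ∈ (D' k').primes, q ∉ T := fun k' q hq h =>
    hPS' k' q hq ((inr_mem_finSupport_iff T q).mpr h)
  -- the uniform bound `B = #Sel⁽³⁾(E/ℚ)` and the `E[3]`-level admissibility for the core-vertex file
  haveI hfinSel : Finite (W.kummerSelmerStructure ((3 : ℕ) : ℤ)).selmerGroup := by
    rw [← selmerGroup_eq_selmerGroup_kummerSelmerStructure]
    exact W.finite_selmerGroup_holds (by norm_num)
  have hker₁ : ∀ k : ℕ, ∀ u : absoluteGaloisGroup ℚ,
      W.torsionGaloisModule (((3 : ℕ) : ℤ) ^ k * ((3 : ℕ) : ℤ)) u = 1 →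
        W.torsionGaloisModule ((3 : ℕ) : ℤ) u = 1 := fun k u hu =>
    S24Deep.torsionGaloisModule_eq_one_of_dvd W (Dvd.intro_left _ rfl) u hu
  have hS₁ : ∀ v : HeightOneSpectrum (𝓞 ℚ), (Sum.inr v : Place ℚ) ∉ finSupport T →
      ((3 : ℕ) : 𝓞 ℚ) ∉ v.asIdeal ∧ GaloisRep.IsUnramifiedAt v (W.torsionGaloisModule ((3 : ℕ) : ℤ)) := by
    intro v hv
    have hvT : v ∉ T := fun h => hv ((inr_mem_finSupport_iff T v).mpr h)
    exact ⟨fun h => hv (h3S v h),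
      S24Deep.isUnramifiedAt_of_ker_le _ _ (hker₁ 0) v (hT 0 v hvT).2⟩
  have h𝓚₁ : (W.kummerSelmerStructure ((3 : ℕ) : ℤ)).IsUnramifiedOutside (finSupport T) := by
    have key : ∀ n : ℤ, n = ((3 : ℕ) : ℤ) ^ 0 * ((3 : ℕ) : ℤ) →
        (W.kummerSelmerStructure n).IsUnramifiedOutside (finSupport T) := by
      intro n hn
      subst hn
      exact h𝓚T 0
    exact key _ (by norm_num)
  -- the row theorem of the predecessor file, fed at every depth `k₀`
  refine EndRow.deepUpper_conclusion_of_endCoreInputs W 0 v₃ hv₃ D hint ha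
    (Nat.card (W.kummerSelmerStructure ((3 : ℕ) : ℤ)).selmerGroup) fun k₀ _ => ?_
  -- the depth `k`: `k₀ ≤ k + 1`, `a < k + 1`, `3^s ∣ 3^{k+1}`
  set k : ℕ := k₀ + 2 * a + 2 * s with hk_def
  haveI := hfinT k
  haveI := hfinS k
  haveI : NeZero (3 ^ (k + 1)) := ⟨pow_ne_zero _ three_ne_zero⟩
  -- (1) the WITNESS from the port at `k′ = k` (the pinned reduction is the identity on points)
  obtain ⟨red, hred⟩ := exists_torsionReduction_three W k k
  obtain ⟨κ, Λ, κ', κu, Λu, κu', hW, -, -⟩ :=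
    hPort k k (D' k) (D' k) red (hDk k) (hDk k) le_rfl hred hadd hc3 hsurj ht0' hv₃ hcP hper
  have hon := hW.2.2.1
  have hker := hW.2.2.2.1
  -- (2) the Poitou–Tate count at `∅` and the exponent `n₀` of the dual Selmer group
  have hcount0 := DeepLedger.natCard_selmerGroup_propagated_eq W 3 k hp2 hv₃ Λ hon hker (inv' k) (hperf' k)
    (hsum' k) (hcompl' k) (hinj' k) hEP T hv₃T (hT k) (h𝓕T k) (h𝓚T k)
  have hfinF : Finite (propagatedSelmerStructure W 3 k).selmerGroup := by
    refine CoreRankZero.finite_selmerGroup_of_le_off {v₃}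
      (𝓛 := W.kummerSelmerStructure (((3 : ℕ) : ℤ) ^ k * ((3 : ℕ) : ℤ))) (fun v hv => le_of_eq ?_)
      inferInstance
    rcases v with w | v
    · exact DeepLedger.apply_inl_eq_of_odd W 3 k hp2 _ _ w
    · have hne : v ≠ v₃ := fun h => hv v₃ (Finset.mem_singleton_self v₃) (by rw [h])
      have hpv : ((3 : ℕ) : 𝓞 ℚ) ∉ v.asIdeal := fun h' =>
        hne (heightOneSpectrum_eq_of_natCast_mem Nat.prime_three h' hv₃)
      exact propagatedSelmerStructure_inr_eq_kummerSelmerStructure W 3 k hpv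
  have hneF : Nat.card (propagatedSelmerStructure W 3 k).selmerGroup ≠ 0 := Nat.card_pos.ne'
  have hN0 : Nat.card ((inv' k).dualSelmerStructure
      (W.torsionGaloisModule (((3 : ℕ) : ℤ) ^ k * ((3 : ℕ) : ℤ)))
      (propagatedSelmerStructure W 3 k)).selmerGroup ≠ 0 := by
    intro h
    rw [h, mul_zero] at hcount0
    exact hneF hcount0
  haveI hfind : Finite ((inv' k).dualSelmerStructure
      (W.torsionGaloisModule (((3 : ℕ) : ℤ) ^ k * ((3 : ℕ) : ℤ)))
      (propagatedSelmerStructure W 3 k)).selmerGroup := Nat.finite_of_card_ne_zero hN0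
  obtain ⟨n₀, hn₀⟩ : ∃ n₀ : ℕ, Nat.card ((inv' k).dualSelmerStructure
      (W.torsionGaloisModule (((3 : ℕ) : ℤ) ^ k * ((3 : ℕ) : ℤ)))
      (propagatedSelmerStructure W 3 k)).selmerGroup = 3 ^ n₀ := by
    refine Transport.exists_natCard_eq_pow_of_nsmul_eq_zero (p := 3) (K := k + 1) fun x => ?_
    refine Subtype.ext ?_
    rw [AddSubgroupClass.coe_nsmul, AddSubgroup.coe_zero]
    exact galoisCohomology.nsmul_eq_zero_of_forall _
      (fun f => DiscreteGaloisModule.TateDual.nsmul_eq_zero f) _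
  have hcount : Nat.card (propagatedSelmerStructure W 3 k).selmerGroup = 3 ^ (k + 1) * 3 ^ n₀ := by
    rw [hcount0, hn₀]
  -- (4) `#Sel_{3^{k+1}}(E/ℚ) = #Ш(E/ℚ)(3)` at the deep level
  have hSelSha := SelmerShaUpper.natCard_selmerGroup_kummer_eq_card_primaryComponent W 3 hirr k
    (by rw [hs]; exact pow_dvd_pow 3 (by omega))
  -- (5) the `L`-value at modulus `3^{k+1}`
  obtain ⟨w₀, hw₀⟩ := LValue.exists_unit_kuriharaNumber_one_eq D.f (k + 1) hne0 hint0 hva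
  -- (5′) the STUB at `∅` FROM ORDERS (this seat, no inline port): `n₀ ≤ s`, the order of `g′ k ∅`
  --      from [S24] Thm. 4.4 (2) at `∅` (`hR22′`), and the port's witness at the deeper depth
  --      `k₂ = k + a + 1` for the class of full order
  haveI := hfinS k
  have hn₀s : n₀ ≤ s := by
    have hle := natCard_selmerGroup_le_of_witness W k (D' k) v₃ hv₃ D hW
    rw [hcount, hSelSha, hs, ← pow_add, ← pow_add] at hle
    have := (Nat.pow_le_pow_iff_right (by norm_num : 1 < 3)).1 hle
    omega
  have hg0 : g' k ∅ ∈ (propagatedSelmerStructure W 3 k).selmerGroup :=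
    ((KolyvaginDatum.mem_kolyvaginSystems_iff _ _ _).mp (hg' k)).apply_empty_mem
  have hgK : 3 ^ (k + 1 - n₀) • g' k ∅ = 0 := by
    have hR := (hR22' k (inv' k) (hperf' k) (hsum' k) (hcompl' k) ∅ (D' k).isLevel_empty).1
    rw [atLevel_empty, hn₀] at hR
    have h1 := hR (pow_dvd_pow 3 (by omega : n₀ ≤ k + 1))
    have h2 : addOrderOf (g' k ∅) = 3 ^ (k + 1 - n₀) := by
      have h3 : addOrderOf (g' k ∅) * 3 ^ n₀ = 3 ^ (k + 1 - n₀) * 3 ^ n₀ := by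
        rw [h1, ← pow_add, Nat.sub_add_cancel (by omega : n₀ ≤ k + 1)]
      exact Nat.eq_of_mul_eq_mul_right (pow_pos (by norm_num : 0 < 3) _) h3
    rw [← h2]
    exact addOrderOf_nsmul_eq_zero (g' k ∅)
  set k₂ : ℕ := k + a + 1 with hk₂_def
  haveI := hfinT k₂
  haveI := hfinS k₂
  haveI : NeZero (3 ^ (k₂ + 1)) := ⟨pow_ne_zero _ three_ne_zero⟩
  obtain ⟨red₂, hred₂⟩ := exists_torsionReduction_three W k₂ k₂
  obtain ⟨κ₂, Λ₂, κ₂', -, -, -, hW₂, -, -⟩ :=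
    hPort k₂ k₂ (D' k₂) (D' k₂) red₂ (hDk k₂) (hDk k₂) le_rfl hred₂ hadd hc3 hsurj ht0' hv₃ hcP hper
  obtain ⟨w₂, hw₂⟩ := LValue.exists_unit_kuriharaNumber_one_eq D.f (k₂ + 1) hne0 hint0 hva
  have hstub := exists_eq_nsmul_add_of_witnesses W hsurj 0 (by omega : k < k₂) (D' k) (D' k₂) v₃ hv₃ D
    hW hW₂ (g' k) hg0 hcount hgK w₀ hw₀ w₂ hw₂ (by omega) (by omega)
  -- (6) the GOOD CORE VERTEX: a residual core vertex of `𝓚` inside the deep class of `τ k` …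
  let D₁ : KolyvaginDatum (W.torsionGaloisModule ((3 : ℕ) : ℤ)) :=
    { primes := (D' k).primes
      transverse := cyclotomicTransverse _
      fs := fun _ => 0 }
  have hτ1 : Nonempty (cokerSubOne (W.torsionGaloisModule ((3 : ℕ) : ℤ)) (τ k) ≃+ ZMod 3) := by
    have h := FrobShape.nonempty_cokerSubOne_equiv_zmod_pow_mul_of_le W Nat.prime_three (Nat.zero_le k)
      (τ k) (hτq k)
    have key : ∀ (n : ℤ) (m : ℕ), n = ((3 : ℕ) : ℤ) ^ 0 * ((3 : ℕ) : ℤ) → m = 3 ^ (0 + 1) →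
        Nonempty (cokerSubOne (W.torsionGaloisModule n) (τ k) ≃+ ZMod m) := by
      intro n m hn hm
      subst hn hm
      exact h
    exact key _ _ (by norm_num) (by norm_num)
  obtain ⟨d, hd₁, hdB, hK₁⟩ :=
    CoreVertex.kummer_exists_isLevel_selmerGroup_eq_bot_three_deep_of_towerSurj W htower hperf hsum hcompl
      hEP hS₁ h𝓚₁ k (hτμ k) hτ1 (D₁ := D₁) (hP' k) rfl
  have hd : (D' k).IsLevel d := hd₁
  -- … lifted to `E[3^{k+1}]` by the dévissage (inline port)
  have hK : ((D' k).atLevel (W.kummerSelmerStructure (((3 : ℕ) : ℤ) ^ k * ((3 : ℕ) : ℤ))) d).selmerGroup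
      = ⊥ := kummerDevissage_of_towerSurj W htower η k (D' k) D₁ d (hDk k) rfl rfl hd hK₁
  -- (7) the vertex inputs `hinj`, `hgd`, `hord`
  have hv₃d : v₃ ∉ d := fun h => hPS' k v₃ (hd h) (h3S v₃ hv₃)
  have hcountd := DeepLedger.natCard_selmerGroup_propagated_atLevel_eq W 3 k hp2 hv₃ Λ hon hker (inv' k)
    (hperf' k) (hsum' k) (hcompl' k) (hinj' k) hEP T hv₃T (hT k) (h𝓕T k) (h𝓚T k) (D' k) (hPSk k)
    (hUT' k) hd
  haveI := CoreRankZero.finite_selmerGroup_atLevel (D' k) (propagatedSelmerStructure W 3 k) hfinF d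
  have hNd : Nat.card ((inv' k).dualSelmerStructure
      (W.torsionGaloisModule (((3 : ℕ) : ℤ) ^ k * ((3 : ℕ) : ℤ)))
      ((D' k).atLevel (propagatedSelmerStructure W 3 k) d)).selmerGroup ≠ 0 := by
    intro h
    rw [h, mul_zero] at hcountd
    exact (Nat.card_pos (α := ((D' k).atLevel (propagatedSelmerStructure W 3 k) d).selmerGroup)).ne'
      hcountd
  haveI : Finite ((inv' k).dualSelmerStructure
      (W.torsionGaloisModule (((3 : ℕ) : ℤ) ^ k * ((3 : ℕ) : ℤ)))
      ((D' k).atLevel (propagatedSelmerStructure W 3 k) d)).selmerGroup := Nat.finite_of_card_ne_zero hNd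
  have hR22d := (hR22' k (inv' k) (hperf' k) (hsum' k) (hcompl' k) d hd).1
  obtain ⟨hinj, hgd, hord⟩ := CoreVertexEnd.vertexInputs_of_kummer_atLevel_eq_bot W 3 k hp2 hv₃ Λ hker
    (D' k) (hg' k) hd hv₃d (inv' k) hcountd hR22d hK
  -- (8) the flags of the vertex level `n(d) = ∏_{q ∈ d} N q`: Kolyvagin product of depth `k + 1 ≥ k₀`,
  --     cyclic, `ν ≤ B`
  have hC : ∀ q ∈ d, q ∈ frobeniusClassPrimes (W.torsionGaloisModule (((3 : ℕ) : ℤ) ^ k * ((3 : ℕ) : ℤ)))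
      {v | (Sum.inr v : Place ℚ) ∈ finSupport T} (τ k) (3 ^ (k + 1)) := fun q hq => by
    have h := hd hq
    rwa [hP' k] at h
  have hprime : ∀ q ∈ d, (Ideal.absNorm q.asIdeal).Prime := fun q _ => FSComp.prime_absNorm_rat q
  have hKP : ∀ q ∈ d, Kato.IsKolyvaginPrime W 3 (k + 1) (Ideal.absNorm q.asIdeal) := fun q hq => by
    rw [Literature.NumberTheory.LFunctions.Chebotarev.absNorm_eq_primesEquiv]
    exact KolyvaginPrime.isKolyvaginPrime_succ_of_mem_frobeniusClassPrimes W k hSbad (hτμ k) (hτq k)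
      (hC q hq)
  have hprod : ∀ c : Finset (HeightOneSpectrum (𝓞 ℚ)),
      (∀ q ∈ c, Kato.IsKolyvaginPrime W 3 (k + 1) (Ideal.absNorm q.asIdeal)) →
        Kato.IsKolyvaginProduct W 3 (k + 1) (∏ q ∈ c, Ideal.absNorm q.asIdeal) := by
    intro c
    induction c using Finset.induction_on with
    | empty =>
      intro _
      rw [Finset.prod_empty]
      exact Kato.IsKolyvaginProduct.one
    | insert q c hqc ih =>
      intro hc
      rw [Finset.prod_insert hqc]
      have hq : Kato.IsKolyvaginPrime W 3 (k + 1) (Ideal.absNorm q.asIdeal) :=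
        hc q (Finset.mem_insert_self q c)
      refine hq.isKolyvaginProduct.mul (ih fun r hr => hc r (Finset.mem_insert_of_mem hr)) ?_
      refine Nat.Coprime.prod_right fun r hr => ?_
      refine (Nat.coprime_primes hq.prime (FSComp.prime_absNorm_rat r)).mpr fun h => ?_
      exact hqc ((Assembly.absNorm_injOn Set.univ (Set.mem_univ q) (Set.mem_univ r) h) ▸ hr)
  have hlevK : Kato.IsKolyvaginProduct W 3 (k + 1) (∏ q ∈ d, Ideal.absNorm q.asIdeal) := hprod d hKP
  have hlev : Kato.IsKolyvaginProduct W 3 k₀ (∏ q ∈ d, Ideal.absNorm q.asIdeal) :=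
    hlevK.mono (by omega)
  have hcyc : IsCyclicKolyvaginLevel W 3 (∏ q ∈ d, Ideal.absNorm q.asIdeal) := by
    refine ⟨hlevK.mono (by omega), fun ℓ _ hℓ => ?_⟩
    -- a prime dividing the product is one of the `N q`, `q ∈ d`
    obtain ⟨q, hq, hℓq⟩ := (Nat.Prime.prime Fact.out).exists_mem_finset_dvd hℓ
    have hℓq' : Ideal.absNorm q.asIdeal = ℓ :=
      ((Nat.prime_dvd_prime_iff_eq Fact.out (hprime q hq)).mp hℓq).symm
    have hpe : ((primesEquiv q : Nat.Primes) : ℕ) = ℓ := by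
      rw [← Literature.NumberTheory.LFunctions.Chebotarev.absNorm_eq_primesEquiv, hℓq']
    exact (natCard_torsion_intModel_eq_of_mem_frobeniusClassPrimes W 3 (Dvd.intro_left _ rfl)
      (dvd_pow_self 3 (Nat.succ_ne_zero k)) hSbad hτ1 (hC q hq) hpe).le
  have hν : (∏ q ∈ d, Ideal.absNorm q.asIdeal).primeFactors.card ≤
      Nat.card (W.kummerSelmerStructure ((3 : ℕ) : ℤ)).selmerGroup := by
    have hinjd : ∀ x ∈ d, ∀ y ∈ d,
        (fun q : HeightOneSpectrum (𝓞 ℚ) => Ideal.absNorm q.asIdeal) x =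
          (fun q : HeightOneSpectrum (𝓞 ℚ) => Ideal.absNorm q.asIdeal) y → x = y :=
      fun x _ y _ h => Assembly.absNorm_injOn Set.univ (Set.mem_univ x) (Set.mem_univ y) h
    have hprodeq : ∏ q ∈ d, Ideal.absNorm q.asIdeal =
        ∏ ℓ ∈ d.image (fun q : HeightOneSpectrum (𝓞 ℚ) => Ideal.absNorm q.asIdeal), ℓ :=
      (Finset.prod_image (f := fun ℓ : ℕ => ℓ) hinjd).symm
    rw [hprodeq, Nat.primeFactors_prod (fun ℓ hℓ => ?_)]
    · exact Finset.card_image_le.trans hdB.le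
    · obtain ⟨q, hq, rfl⟩ := Finset.mem_image.mp hℓ
      exact hprime q hq
  -- (9) assemble the END-core inputs at this depth
  exact ⟨k, D' k, κ, Λ, κ', hW, g' k, hgen' k, n₀, hcount, hstub, hSelSha, by omega, w₀, hw₀, d, hd,
    hprime, hcyc, hlev, hν, hinj, hgd, hord⟩


end Summit.BirchSwinnertonDyer.BirchSwinnertonDyer.Theorems.KimAtThreeShallowEqDeepStubOfPorts

end
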